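import Mathlib
import HarnessLib
import Literature.Probability.Percolation.Percolation
import Summits.CriticalPhenomena.PercolationContinuityZ3.Theorems.PercNearOneGluingNoHeavyLowerTailAntipodalCutVertexGraph

/-!
# Vertex-cover T2, part I: colourings, the swap involution `Φ`, the `A`- and `B`-sets

Helper file for crux `stmt-CriticalPhenomena-4575` (`NoHeavyLowerTail`, route `PercNearOneGluingNoHeavy`),
new-inequality factory seat `prim-ineq-gen-1` (gen 10).  Everything here is PROVED; no route definition is touched.
Memo: `run/shared/lean/prim/prim-ineq-gen-1/FINDING-16-T2one-and-territory-reduction.md` §7 (THEOREM VC).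

Setting.  A multigraph is a vertex type `V` with free edges labelled by a finite type `ι` through `e : ι → Sym2 V`
(labels need not be injective: parallel edges allowed).  A colouring is `X : Finset ι`; its red configuration is
`e '' X`, its blue configuration `e '' Xᶜ`; `openGraph ω = SimpleGraph.fromEdgeSet ω` (`Literature.Probability.Percolation`).
For terminals `a v b c` the conjectured fibrewise SPLIT inequality ("T2", FINDING-12 §7) reads `A ≤ B` with
`A = #{X : red partition of {a,v,b,c} = av|bc, blue partition = a|v|b|c}` and
`B = #{X : red partition = av|b|c, blue partition = a|v|bc}`.

**THEOREM VC** (`card_A_le_card_B_of_vertexCover`, in `…VertexCoverT2.lean`, which imports this file).  If every edge has an endpoint among `a, v, b, c` (the terminals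
form a VERTEX COVER — e.g. `K_{4,k}` with the terminals on one side, satellite clouds with arbitrary multiplicities and
terminal–terminal edges), then `A ≤ B`.  Proof: let `S` be the set of free edges that are `b–c` edges or lie at a satellite
(non-terminal vertex) adjacent to both `b` and `c`; the map `Φ X = X ∆ S` (swap the colours on `S`) is an involution of
all colourings and maps the `A`-set into the `B`-set (`phi_mem_B`).  Graph-theoretic input: in a vertex-cover graph every
edge at a satellite ends at a terminal, so monochromatic clusters are analysed through "closed" vertex sets; in an `A`-colouring
a satellite's blue edges all go to one terminal, its red edges never join `{a,v}` to `{b,c}`, and a satellite adjacent to both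
`b` and `c` has no red edge to `a` or `v`.
This is the first case of T2 with unboundedly many internally disjoint `S–T` paths (not a cut-vertex, 2-separator, pendant or
series–parallel situation).  (Found and proved by this seat, 2026-08-20.)
-/

namespace Summit.CriticalPhenomena.PercolationContinuityZ3.Theorems

namespace VertexCoverT2

open Finset Literature.Probability.Percolation AntipodalCutVertex

variable {V : Type*} {ι : Type*} [DecidableEq ι] [Fintype ι]

/-- The configuration (set of open edges) of a set of free-edge labels. [this work] -/
def col (e : ι → Sym2 V) (X : Finset ι) : Set (Sym2 V) := e '' (↑X : Set ι)

omit [DecidableEq ι] [Fintype ι] in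
/-- Membership in a configuration. [this work] -/
theorem mem_col {e : ι → Sym2 V} {X : Finset ι} {z : Sym2 V} : z ∈ col e X ↔ ∃ i ∈ X, e i = z := by
  unfold col
  rw [Set.mem_image]
  simp only [Finset.mem_coe]

omit [DecidableEq ι] [Fintype ι] in
/-- Closed sets contain clusters: if `W ∋ s` is closed under the open edges then everything reachable from `s` lies
in `W`. [this work] -/
theorem mem_of_reachable {ω : Set (Sym2 V)} {W : Set V} {s y : V} (hs : s ∈ W)
    (hW : ∀ p q, p ∈ W → s(p, q) ∈ ω → q ∈ W) (h : (openGraph ω).Reachable s y) : y ∈ W := by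
  rw [reachable_iff] at h
  induction h with
  | refl => exact hs
  | tail _ hpq ih => exact hW _ _ ih hpq

omit [DecidableEq ι] [Fintype ι] in
/-- Two unordered pairs with a common first entry have equal second entries. [this work] -/
theorem snd_eq_of_eq {p q t : V} (h : s(p, q) = s(p, t)) : q = t := by
  rcases Sym2.eq_iff.mp h with ⟨_, h2⟩ | ⟨h1, h2⟩
  · exact h2
  · rw [h2, h1]

/-- `t` is one of the four terminals. [this work] -/
def IsT (a v b c t : V) : Prop := a = t ∨ v = t ∨ b = t ∨ c = t

/-- A satellite (non-terminal vertex) adjacent to both `b` and `c`. [this work] -/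
def BcSat (e : ι → Sym2 V) (a v b c x : V) : Prop :=
  ¬ IsT a v b c x ∧ (∃ j, e j = s(x, b)) ∧ ∃ j, e j = s(x, c)

open scoped Classical in
/-- The swapped labels: `b–c` edges and all edges at satellites adjacent to both `b` and `c`. [this work] -/
noncomputable def swapSet (e : ι → Sym2 V) (a v b c : V) : Finset ι :=
  Finset.univ.filter (fun i => e i = s(b, c) ∨ ∃ x, BcSat e a v b c x ∧ x ∈ e i)

/-- The involution `Φ X = X ∆ S`. [this work] -/
noncomputable def phi (e : ι → Sym2 V) (a v b c : V) (X : Finset ι) : Finset ι :=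
  symmDiff X (swapSet e a v b c)

/-- `Φ` is an involution. [this work] -/
theorem phi_phi (e : ι → Sym2 V) (a v b c : V) (X : Finset ι) : phi e a v b c (phi e a v b c X) = X := by
  rw [phi, phi, symmDiff_assoc, symmDiff_self, symmDiff_bot]

/-- The `A`-set of T2: red partition `av|bc`, blue partition `a|v|b|c` (minimal literal form). [this work] -/
def InA (e : ι → Sym2 V) (a v b c : V) (X : Finset ι) : Prop :=
  (openGraph (col e X)).Reachable a v ∧ (openGraph (col e X)).Reachable b c ∧ ¬ (openGraph (col e X)).Reachable a b ∧
    ¬ (openGraph (col e Xᶜ)).Reachable a v ∧ ¬ (openGraph (col e Xᶜ)).Reachable a b ∧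
      ¬ (openGraph (col e Xᶜ)).Reachable a c ∧ ¬ (openGraph (col e Xᶜ)).Reachable v b ∧
        ¬ (openGraph (col e Xᶜ)).Reachable v c ∧ ¬ (openGraph (col e Xᶜ)).Reachable b c

/-- The `B`-set of T2: red partition `av|b|c`, blue partition `a|v|bc` (minimal literal form). [this work] -/
def InB (e : ι → Sym2 V) (a v b c : V) (X : Finset ι) : Prop :=
  (openGraph (col e X)).Reachable a v ∧ ¬ (openGraph (col e X)).Reachable a b ∧ ¬ (openGraph (col e X)).Reachable a c ∧
    ¬ (openGraph (col e X)).Reachable b c ∧ (openGraph (col e Xᶜ)).Reachable b c ∧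
      ¬ (openGraph (col e Xᶜ)).Reachable a v ∧ ¬ (openGraph (col e Xᶜ)).Reachable a b ∧
        ¬ (openGraph (col e Xᶜ)).Reachable v b

section Swap

variable (e : ι → Sym2 V) (a v b c : V)

/-- Labels outside the swap set keep their colour. [this work] -/
theorem mem_phi_of_not_mem {X : Finset ι} {i : ι} (hi : i ∉ swapSet e a v b c) :
    i ∈ phi e a v b c X ↔ i ∈ X := by
  simp [phi, Finset.mem_symmDiff, hi]

/-- Labels in the swap set change colour. [this work] -/
theorem mem_phi_of_mem {X : Finset ι} {i : ι} (hi : i ∈ swapSet e a v b c) :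
    i ∈ phi e a v b c X ↔ i ∉ X := by
  simp [phi, Finset.mem_symmDiff, hi]

omit [DecidableEq ι] in
/-- Characterisation of the swap set. [this work] -/
theorem mem_swapSet {i : ι} : i ∈ swapSet e a v b c ↔ e i = s(b, c) ∨ ∃ x, BcSat e a v b c x ∧ x ∈ e i := by
  classical
  simp [swapSet]

end Swap

end VertexCoverT2

end Summit.CriticalPhenomena.PercolationContinuityZ3.Theorems
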